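import Literature.NumberTheory.Automorphic.QuaternionAdelicTorus
import Literature.NumberTheory.Automorphic.QuaternionAdelicUnitsPlacesSplitting
import HarnessLib

/-!
# Naturality of the place decomposition `D_𝔸ˣ = D_Sˣ × D^{S,×}` under `K`-algebra maps `D' → D`
(Gelbart, *Automorphic forms on adele groups* (1975), §10, pp. 153–155: the tori `B_𝔸 = B_S × B^S`,
`B'_𝔸 = B'_S × B'^S` of the two trace formulas are decomposed along the places compatibly with the
embeddings `B'_𝔸 = E_𝔸ˣ ↪ D_𝔸ˣ`, `B_𝔸 = E_𝔸ˣ ↪ GL₂(𝔸)`)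

Topic `NumberTheory/Automorphic`; one small definition with body (`localUnitsMapRight`, the map
`D'_vˣ → D_vˣ` induced by a `K`-algebra map `f : D' → D` — the local twin of `unitsMapRight`) and
theorems; no named fact, no instance. For a `K`-algebra map `f : D' →ₐ[K] D` between
finite-dimensional `K`-algebras the induced map `f_𝔸 = unitsMapRight K D f : D'_𝔸ˣ → D_𝔸ˣ`
(`QuaternionAdelicTorus`) is compatible with every piece of the place decomposition of
`QuaternionAdelicUnitsPlacesSplitting`:

* `ScalarExtension.mapLeft_mapRight` — `(g ⊗ 1) ∘ (1 ⊗ f) = (1 ⊗ f) ∘ (g ⊗ 1)` on `R ⊗_K D'`;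
* `toCompletionUnits_unitsMapRight` — **`(f_𝔸 u)_v = f_v(u_v)`**;
* `Quat.localToAdelic_mapRight`, `unitsMapRight_ofLocal` — **`f_𝔸 (ι_v t) = ι_v (f_v t)`**;
* `unitsMapRight_mem_trivialAt` — `f_𝔸 (D'^{S,×}) ⊆ D^{S,×}`;
* `unitsMapRight_toAdelicPi` — `f_𝔸 (ι_S t) = ι_S (f_S t)`;
* `unitsMapRight_awayFromPlaces` — `f_𝔸 (s_S x) = s_S (f_𝔸 x)`;
* `unitsMapRight_placesSplitting` — **`f_𝔸 ∘ splitting' = splitting ∘ (f_S × f_𝔸|_{D'^{S,×}})`**.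

Applied to the inclusion `E = K(γ') ↪ D` of the quadratic subfield of a regular `γ' ∈ Dˣ` (whose
adelic points form the centraliser `B'_𝔸 = C(γ')`, `centralizer_inclAdelic_eq_range`) and to
`E ≅ K(γ) ↪ M₂(K)`, this is the compatibility of Gelbart's identification `B'_𝔸 ≅ B_𝔸` (p. 155) with
the factorisations `Π_{v ∈ S} (⋯) × (⋯)^S` of (10.19). Part of the inline (D-0026) decomposition of
`Literature.NumberTheory.Automorphic.strong_multiplicity_one_quaternionUnits`.

## References

* S. Gelbart, *Automorphic forms on adele groups*, Ann. of Math. Studies 83 (1975), §10,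
  pp. 153–155 [Gelbart1975].
* A. Weil, *Basic Number Theory* (1967), Ch. IV §1 (tensoring places with a finite-dimensional
  algebra) [WeilBNT1967].
-/

noncomputable section

open NumberField IsDedekindDomain Topology
open scoped TensorProduct

universe u v

namespace Literature.NumberTheory.Automorphic

/-! ### `mapLeft` and `mapRight` commute -/

namespace ScalarExtension

variable (K : Type*) [Field K] {R : Type*} [CommRing R] [Algebra K R] {R' : Type*} [CommRing R'] [Algebra K R']
  {D : Type*} [Ring D] [Algebra K D] {D' : Type*} [Ring D'] [Algebra K D']

/-- **`(g ⊗ 1) ∘ (1 ⊗ f) = (1 ⊗ f) ∘ (g ⊗ 1)`**: scalar extension is a bifunctor. [folklore] -/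
theorem mapLeft_mapRight (g : R →ₐ[K] R') (f : D' →ₐ[K] D) (x : ScalarExtension K R D') :
    mapLeft K D g (mapRight K R f x) = mapRight K R' f (mapLeft K D' g x) := by
  induction x using induction_on' K R D' with
  | zero => simp only [map_zero]
  | tmul r d => rw [mapRight_tmul, mapLeft_tmul, mapLeft_tmul, mapRight_tmul]
  | add X Y hX hY => rw [map_add, map_add, hX, hY, map_add, map_add]

end ScalarExtension

/-! ### The local maps `D'_vˣ → D_vˣ` -/

section Local

variable (K : Type) [Field K] [NumberField K] (D : Type u) [Ring D] [Algebra K D]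
  {D' : Type v} [Ring D'] [Algebra K D'] (v : HeightOneSpectrum (𝓞 K))

/-- **The map `D'_vˣ →* D_vˣ` induced by a `K`-algebra map `f : D' → D`** (`Units.map` of
`ScalarExtension.mapRight` over `K_v`); the local twin of `unitsMapRight`. [folklore] -/
def localUnitsMapRight (f : D' →ₐ[K] D) : completionUnits D' v →* completionUnits D v :=
  Units.map (ScalarExtension.mapRight K (v.adicCompletion K) f).toRingHom.toMonoidHom

variable {K D v}

/-- `localUnitsMapRight f t = mapRight f t` on underlying elements (definitional). [folklore] -/
@[simp]
theorem val_localUnitsMapRight (f : D' →ₐ[K] D) (t : completionUnits D' v) :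
    ((localUnitsMapRight K D v f t : completionUnits D v) : ScalarExtension K (v.adicCompletion K) D) =
      ScalarExtension.mapRight K (v.adicCompletion K) f t := rfl

variable (K D v) in
/-- `localUnitsMapRight f` is continuous (`D'`, `D` finite-dimensional). [folklore] -/
theorem continuous_localUnitsMapRight [Module.Finite K D'] [Module.Finite K D] (f : D' →ₐ[K] D) :
    Continuous (localUnitsMapRight K D v f) :=
  Continuous.units_map _ (ScalarExtension.continuous_mapRight K (v.adicCompletion K) f)

variable (K D v) in
/-- `localUnitsMapRight f` is injective for injective `f`. [folklore] -/
theorem localUnitsMapRight_injective (f : D' →ₐ[K] D) (hf : Function.Injective f) :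
    Function.Injective (localUnitsMapRight K D v f) :=
  Units.map_injective (ScalarExtension.mapRight_injective K (v.adicCompletion K) f hf)

/-- **`(f_𝔸 u)_v = f_v (u_v)`**: the induced maps commute with the projections to the components.
[folklore] -/
theorem toCompletionUnits_unitsMapRight (f : D' →ₐ[K] D) (u : adelicUnits K D') :
    toCompletionUnits K D v (unitsMapRight K D f u) = localUnitsMapRight K D v f (toCompletionUnits K D' v u) := by
  ext1
  exact ScalarExtension.mapLeft_mapRight K (adeleEvalAlgHom K v) f _

/-- **`f_𝔸 ∘ ι_v = ι_v ∘ f_v` on the algebras**: the factor inclusions `D'_v → D'_𝔸`, `D_v → D_𝔸` are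
natural in the algebra. [folklore] -/
theorem Quat.localToAdelic_mapRight (f : D' →ₐ[K] D) (x : ScalarExtension K (v.adicCompletion K) D') :
    Quat.localToAdelic K D v (ScalarExtension.mapRight K (v.adicCompletion K) f x) =
      ScalarExtension.mapRight K (AdeleRing (𝓞 K) K) f (Quat.localToAdelic K D' v x) := by
  induction x using ScalarExtension.induction_on' K (v.adicCompletion K) D' with
  | zero => simp only [map_zero]
  | tmul a y =>
    rw [ScalarExtension.mapRight_tmul]
    change ScalarExtension.ofTensor K _ D (adeleSingleHom K v a ⊗ₜ[K] f y) =
      ScalarExtension.mapRight K (AdeleRing (𝓞 K) K) f (ScalarExtension.ofTensor K _ D' (adeleSingleHom K v a ⊗ₜ[K] y))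
    rw [ScalarExtension.mapRight_tmul]
  | add X Y hX hY => rw [map_add, map_add, hX, hY, map_add, map_add]

/-- **`f_𝔸 (ι_v t) = ι_v (f_v t)`**: the induced maps commute with the local embeddings. [folklore] -/
theorem unitsMapRight_ofLocal (f : D' →ₐ[K] D) (t : completionUnits D' v) :
    unitsMapRight K D f (Quat.ofLocal K D' v t) = Quat.ofLocal K D v (localUnitsMapRight K D v f t) := by
  ext1
  rw [val_unitsMapRight, Quat.coe_ofLocal, Quat.coe_ofLocal, map_add, map_one, ← Quat.localToAdelic_mapRight,
    map_sub, map_one, val_localUnitsMapRight]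

end Local

/-! ### Naturality of the decomposition along a finite set of places -/

section Places

variable {K : Type} [Field K] [NumberField K] {D : Type u} [Ring D] [Algebra K D]
  {D' : Type v} [Ring D'] [Algebra K D'] {S : Finset (HeightOneSpectrum (𝓞 K))}

/-- **`f_𝔸 (D'^{S,×}) ⊆ D^{S,×}`.** [folklore] -/
theorem unitsMapRight_mem_trivialAt (f : D' →ₐ[K] D) {c : adelicUnits K D'} (hc : c ∈ Quat.trivialAt K D' S) :
    unitsMapRight K D f c ∈ Quat.trivialAt K D S := by
  rw [Quat.mem_trivialAt_iff] at hc ⊢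
  intro v hv
  rw [toCompletionUnits_unitsMapRight, hc v hv, map_one]

/-- **`f_𝔸 (ι_S t) = ι_S (f_S t)`** with `f_S t = (f_v t_v)_{v ∈ S}`. [folklore] -/
theorem unitsMapRight_toAdelicPi (f : D' →ₐ[K] D) (t : Quat.LocalPi K D' S) :
    unitsMapRight K D f (Quat.toAdelicPi K D' S t) =
      Quat.toAdelicPi K D S (fun v => localUnitsMapRight K D (v : HeightOneSpectrum (𝓞 K)) f (t v)) := by
  classical
  rw [Quat.toAdelicPi_apply, Quat.toAdelicPi_apply, Finset.map_noncommProd]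
  refine Finset.noncommProd_congr rfl (fun w _ => ?_) _
  exact unitsMapRight_ofLocal f (t w)

/-- **`f_𝔸 (s_S x) = s_S (f_𝔸 x)`**: the parts away from `S` correspond. [folklore] -/
theorem unitsMapRight_awayFromPlaces (f : D' →ₐ[K] D) (x : adelicUnits K D') :
    unitsMapRight K D f (Quat.awayFromPlaces K D' S x) = Quat.awayFromPlaces K D S (unitsMapRight K D f x) := by
  rw [Quat.awayFromPlaces, Quat.awayFromPlaces, map_mul, map_inv, unitsMapRight_toAdelicPi]
  congr 3
  funext v
  rw [toCompletionUnits_unitsMapRight]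

/-- **`f_𝔸 ∘ splitting' = splitting ∘ (f_S × f_𝔸|_{D'^{S,×}})`**: the induced map in the coordinates
`D'_𝔸ˣ = D'_Sˣ × D'^{S,×}`, `D_𝔸ˣ = D_Sˣ × D^{S,×}`. [cite: Gelbart1975, §10 p. 153] -/
theorem unitsMapRight_placesSplitting [Module.Finite K D'] [Module.Finite K D] (f : D' →ₐ[K] D)
    (p : Quat.LocalPi K D' S × Quat.trivialAt K D' S) :
    unitsMapRight K D f (Quat.placesSplitting K D' S p) =
      Quat.placesSplitting K D S
        (fun v => localUnitsMapRight K D (v : HeightOneSpectrum (𝓞 K)) f (p.1 v),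
          ⟨unitsMapRight K D f (p.2 : adelicUnits K D'), unitsMapRight_mem_trivialAt f p.2.2⟩) := by
  rw [Quat.placesSplitting_apply, Quat.placesSplitting_apply, map_mul, unitsMapRight_toAdelicPi]

/-- The `S`-components of `f_𝔸 x` are the `f_v (x_v)`: first coordinate of the inverse splitting.
[folklore] -/
theorem placesSplitting_symm_unitsMapRight_fst [Module.Finite K D'] [Module.Finite K D] (f : D' →ₐ[K] D)
    (x : adelicUnits K D') (v : S) :
    ((Quat.placesSplitting K D S).symm (unitsMapRight K D f x)).1 v =
      localUnitsMapRight K D (v : HeightOneSpectrum (𝓞 K)) f (((Quat.placesSplitting K D' S).symm x).1 v) := by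
  rw [Quat.placesSplitting_symm_apply_fst, Quat.placesSplitting_symm_apply_fst, toCompletionUnits_unitsMapRight]

/-- The part away from `S` of `f_𝔸 x` is `f_𝔸` of the part away from `S` of `x`: second coordinate
of the inverse splitting. [folklore] -/
theorem placesSplitting_symm_unitsMapRight_snd [Module.Finite K D'] [Module.Finite K D] (f : D' →ₐ[K] D)
    (x : adelicUnits K D') :
    (((Quat.placesSplitting K D S).symm (unitsMapRight K D f x)).2 : adelicUnits K D) =
      unitsMapRight K D f (((Quat.placesSplitting K D' S).symm x).2 : adelicUnits K D') := by
  rw [Quat.placesSplitting_symm_apply_snd, Quat.placesSplitting_symm_apply_snd, unitsMapRight_awayFromPlaces]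

/-- **The inverse splittings correspond**: `splitting⁻¹ (f_𝔸 x) = (f_S × f_𝔸) (splitting'⁻¹ x)`.
[cite: Gelbart1975, §10 p. 153] -/
theorem placesSplitting_symm_unitsMapRight [Module.Finite K D'] [Module.Finite K D] (f : D' →ₐ[K] D)
    (x : adelicUnits K D') :
    (Quat.placesSplitting K D S).symm (unitsMapRight K D f x) =
      (fun v : S => localUnitsMapRight K D (v : HeightOneSpectrum (𝓞 K)) f (((Quat.placesSplitting K D' S).symm x).1 v),
        ⟨unitsMapRight K D f (((Quat.placesSplitting K D' S).symm x).2 : adelicUnits K D'),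
          unitsMapRight_mem_trivialAt f ((Quat.placesSplitting K D' S).symm x).2.2⟩) := by
  refine Prod.ext (funext fun v => placesSplitting_symm_unitsMapRight_fst f x v) (Subtype.ext ?_)
  exact placesSplitting_symm_unitsMapRight_snd f x

end Places

end Literature.NumberTheory.Automorphic
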